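import Mathlib.NumberTheory.Divisors
import Mathlib.Data.Nat.Prime.Basic
import HarnessLib

/-!
# RAD certificate lists: the COVERAGE condition over the divisors of `D·l` (`l` prime, `l ∤ D`) from the divisors of `D` alone

PROOF-ONLY arithmetic file (no `def`, no new `Prop`, no instance) of the abc-iut cell (WAVE-5 prover seat abc-iut-w5-d236, gen 9; D-0079 R-W
«WINDOW Θ-SIDE INEQUALITY», CLAIM «W:RAD-GENUINEK lane=P−»). Nothing here mentions a Θ-datum; TAKES NO SIDE on [IUTchIII] Cor. 3.12.

The certificate-list theorem `GenuineK.not_pilotKummerCompatHull_chosen_triple_of_radCerts` (this seat, p467119) asks for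
`∀ e ∈ Nat.divisors m, ∃ t ∈ certs, t.1 = e`. At the Tate-exact local types `m = D·l` (`D ∈ {2, 6, 10, 30}`, `l` the datum's prime,
`l ∤ D`), and a brute-force `decide` over `Nat.divisors (D·l)` exceeds the elaborator's recursion depth once `D·l` is in the high hundreds
(`l = 149`, `m = 894`). The divisors of `D·l` are the divisors `d` of `D` and their multiples `d·l`:

* `RadRow.dvd_or_dvd_of_dvd_mul_prime` — `e ∣ D·l`, `l` prime ⇒ `e ∣ D` or `e = e'·l` with `e' ∣ D`;
* `RadRow.cover_of_prime` — coverage over `Nat.divisors (D·l)` from coverage of `{d}` and `{d·l}`, `d ∈ Nat.divisors D` (two `decide`s over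
  the divisors of `D ≤ 30`, independent of `l`).
[folklore]
-/

namespace Summit.ABC.IUTFork.Conditional

namespace RadRow

/-- `e ∣ D·l` with `l` prime: either `e ∣ D`, or `l ∣ e` and `e / l ∣ D` (written as `e = e'·l`, `e' ∣ D`). [folklore] -/
theorem dvd_or_dvd_of_dvd_mul_prime {D l e : ℕ} (hl : l.Prime) (hed : e ∣ D * l) :
    e ∣ D ∨ ∃ e', e = e' * l ∧ e' ∣ D := by
  by_cases hle : l ∣ e
  · obtain ⟨e', rfl⟩ := hle
    refine Or.inr ⟨e', mul_comm _ _, ?_⟩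
    rw [mul_comm D l] at hed
    exact Nat.dvd_of_mul_dvd_mul_left hl.pos hed
  · exact Or.inl (((hl.coprime_iff_not_dvd).2 hle).symm.dvd_of_dvd_mul_right hed)

/-- **Coverage over `Nat.divisors (D·l)` from the divisors of `D`.** If every divisor `d` of `D` (`D ≠ 0`) has a certificate with first
entry `d` and one with first entry `d·l`, then every divisor of `D·l` (`l` prime) has one. [folklore] -/
theorem cover_of_prime {D l : ℕ} (hl : l.Prime) (hD : D ≠ 0) (certs : List (ℕ × ℕ × ℕ × ℤ))
    (h1 : ∀ d ∈ Nat.divisors D, ∃ t ∈ certs, t.1 = d) (h2 : ∀ d ∈ Nat.divisors D, ∃ t ∈ certs, t.1 = d * l) :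
    ∀ e ∈ Nat.divisors (D * l), ∃ t ∈ certs, t.1 = e := by
  intro e he
  obtain ⟨hed, -⟩ := Nat.mem_divisors.1 he
  rcases dvd_or_dvd_of_dvd_mul_prime hl hed with h | ⟨e', rfl, he'⟩
  · exact h1 e (Nat.mem_divisors.2 ⟨h, hD⟩)
  · exact h2 e' (Nat.mem_divisors.2 ⟨he', hD⟩)

end RadRow

end Summit.ABC.IUTFork.Conditional
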